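import Summits.FinalStateConjecture.FinalStateConjecture.Theorems.BulkKerrCaptureC2.Negative.BlockForm
import Literature.Geometry.Lorentzian.KerrStabilitySubextremalCauchy
import HarnessLib

/-!
# `BulkKerrCaptureC2` — normal form: the crux IS the `C²` unit-leaf capture germ

Crux `stmt-FinalStateConjecture-14985`
(`Summit.FinalStateConjecture.FinalStateConjecture.Theses.PhaseMixingCapture.BulkKerrCaptureC2`, rank 4 of
`route-FinalStateConjecture-PhaseMixingCapture`), line `SketchStandalone` (= idea
`all-orders-lebesgue-port`), line lead `prover-line-stmt-FinalStateConjecture-14985-c1-0` (continuation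
of `…-14985-0`). Helper file (`--supports`), closes nothing by itself.

The line is complete modulo ONE named fact, the claim-tagged
`Literature.Geometry.Lorentzian.hintz_kerr_stability_subextremal_cauchy_allOrders` (Hintz,
arXiv:2606.28253v2, Thm. 13.1 + (13.2) + Rem. 13.2, UNREFEREED):
`Theorems.bulkKerrCaptureC2_of_allOrdersClaim` (p99464). This file records, over TREE names, exactly
WHICH slice of that claim the crux consumes and that it consumes nothing less:

* `uniform_of_locallyUniform` — the abstract spin-cover lemma (Lebesgue number of a finite subcover of
  `[−a₁, a₁] ⊂ (−1, 1)`): a predicate monotone in `(s, δ)` and antitone in `ε` that holds on an open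
  spin-neighbourhood of every normalised sub-extremal centre holds with `(s, δ)` uniform and, per
  `(M, η)`, `ε` uniform on `|a| ≤ a₁ M`;
* `bulkKerrCaptureC2_iff_locallyUniform` — NORMAL FORM: `BulkKerrCaptureC2` ↔ locally-uniform
  pointwise `C²` capture at the unit normalised leaf (block `BulkKerrCaptureC2.Negative.CaptureC2At`);
* `stub_bulkKerrCaptureC2_iff_unitLeafGermTwo` (registered Stub 4 of skeleton v3) — the same with the
  block unfolded in the LITERAL shape of
  `hintz_kerr_stability_subextremal_cauchy_allOrders.atUnitLeaf` with `∀ k` replaced by `k = 2`: the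
  crux is EQUIVALENT to the order-two unit-leaf germ form of Hintz's Remark 13.2;
* `stub_unitLeafGermTwo_of_allOrdersClaim` (registered Stub 3 of skeleton v3) — that germ from the named
  claim (`….atUnitLeaf`, `k := 2`); composed with `stub_bulkKerrCaptureC2_iff_unitLeafGermTwo.2` it
  re-derives the landed conditional
  `Theorems.bulkKerrCaptureC2_of_allOrdersClaim'` (p99464; not restated here).

So the item is `blocked-on` the named claim in the precise sense: crux ⇔ (unit-leaf, `k = 2`,
locally-uniform-in-the-centre instance of the claim); any source proving that instance closes it, and a
proof of the crux is a proof of that instance.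
-/

-- the doubled `FinalStateConjecture.FinalStateConjecture` path component trips dupNamespace
set_option linter.dupNamespace false

noncomputable section

open Set Filter Topology Function
open scoped Manifold ContDiff ENNReal Topology
open Literature.Geometry.Lorentzian
open Summit.FinalStateConjecture.FinalStateConjecture.Theses.PhaseMixingCapture (BulkKerrCaptureC2)
open Summit.FinalStateConjecture.FinalStateConjecture.Theorems.BulkKerrCapture

namespace Summit.FinalStateConjecture.FinalStateConjecture.Theorems.BulkKerrCaptureC2.NormalForm

/-- **Abstract spin-cover lemma (Lebesgue number).** Let `Good s δ M hM η ε a` be monotone in the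
exponents `(s, δ)` and antitone in the radius `ε`. If every normalised centre `χ` with `|χ| < 1` has
exponents `(s, δ)`, a spin radius `ς > 0` and, per `(M, η)`, a radius `ε > 0` serving every spin with
`|a/M − χ| < ς`, then for every `a₁ < 1` some `(s, δ)` and, per `(M, η)`, some `ε > 0` serve every
`|a| ≤ a₁ M`: cover the compact segment `[−a₁, a₁] ⊂ (−1, 1)` by the spin balls, extract a finite
subcover, take `max s`, `max δ` and, per `(M, η)`, `min ε`. [folklore] -/
theorem uniform_of_locallyUniform
    (Good : ℕ → ℝ → (M : ℝ) → 0 < M → ℝ → ℝ → ℝ → Prop)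
    (hmono : ∀ {s s' : ℕ} {δ δ' : ℝ} {M : ℝ} {hM : 0 < M} {η ε ε' a : ℝ},
      s ≤ s' → δ ≤ δ' → ε' ≤ ε → Good s δ M hM η ε a → Good s' δ' M hM η ε' a)
    (hloc : ∀ χ : ℝ, |χ| < 1 → ∃ (s : ℕ) (δ : ℝ), ∃ ς > (0 : ℝ), ∀ (M : ℝ) (hM : 0 < M),
      ∀ η > (0 : ℝ), ∃ ε > (0 : ℝ), ∀ a : ℝ, |a / M - χ| < ς → Good s δ M hM η ε a) :
    ∀ a₁ : ℝ, a₁ < 1 → ∃ (s : ℕ) (δ : ℝ), ∀ (M : ℝ) (hM : 0 < M), ∀ η > (0 : ℝ), ∃ ε > (0 : ℝ),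
      ∀ a : ℝ, |a| ≤ a₁ * M → Good s δ M hM η ε a := by
  intro a₁ ha₁
  classical
  rcases lt_or_ge a₁ 0 with hneg | hnn
  · exact ⟨0, 0, fun M hM η _ ↦ ⟨1, one_pos, fun a ha ↦
      (Negative.no_spin_of_neg hneg hM ha).elim⟩⟩
  set K : Set ℝ := Icc (-a₁) a₁ with hK
  have hKc : IsCompact K := isCompact_Icc
  have hKsub : ∀ χ ∈ K, |χ| < 1 := fun χ hχ ↦ by
    rw [hK, mem_Icc] at hχ
    exact abs_lt.2 ⟨by linarith [hχ.1], by linarith [hχ.2]⟩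
  choose! s δ ς hς hcap using fun χ (hχ : χ ∈ K) ↦ hloc χ (hKsub χ hχ)
  have hcover : K ⊆ ⋃ χ ∈ K, Metric.ball χ (ς χ) := fun χ hχ ↦
    mem_biUnion hχ (Metric.mem_ball_self (hς χ hχ))
  obtain ⟨t, htK, htfin, hsub⟩ :=
    hKc.elim_finite_subcover_image (fun χ _ ↦ Metric.isOpen_ball) hcover
  have hKne : K.Nonempty := ⟨0, by rw [hK, mem_Icc]; exact ⟨by linarith, hnn⟩⟩
  have htne : t.Nonempty := by
    obtain ⟨x, hx⟩ := hKne
    have hx' := hsub hx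
    simp only [mem_iUnion] at hx'
    obtain ⟨i, hi, -⟩ := hx'
    exact ⟨i, hi⟩
  obtain ⟨iS, -, hsmax⟩ := t.exists_max_image s htfin htne
  obtain ⟨iD, -, hdmax⟩ := t.exists_max_image δ htfin htne
  refine ⟨s iS, δ iD, fun M hM η hη ↦ ?_⟩
  choose! ε hε hbody using fun χ (hχ : χ ∈ t) ↦ hcap χ (htK hχ) M hM η hη
  obtain ⟨iE, hiEt, hemin⟩ := t.exists_min_image ε htfin htne
  refine ⟨ε iE, hε iE hiEt, fun a ha ↦ ?_⟩
  have hχK : a / M ∈ K := by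
    rw [hK, mem_Icc, ← abs_le, abs_div, abs_of_pos hM, div_le_iff₀ hM]
    exact ha
  have ha' := hsub hχK
  simp only [mem_iUnion] at ha'
  obtain ⟨χ₀, hχ₀t, hball⟩ := ha'
  have hnear : |a / M - χ₀| < ς χ₀ := by simpa [Metric.mem_ball, Real.dist_eq] using hball
  exact hmono (hsmax χ₀ hχ₀t) (hdmax χ₀ hχ₀t) (hemin χ₀ hχ₀t) (hbody χ₀ hχ₀t a hnear)

/-- A spin within `(1 − |χ|)/2` of a normalised centre `χ` (in units of a positive mass `M`) lies
below the threshold `a₁ := (1 + |χ|)/2 < 1`: `|a| ≤ (1 + |χ|)/2 · M`. [folklore] -/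
theorem spin_le_of_near_centre {M a χ : ℝ} (hM : 0 < M) (h : |a / M - χ| < (1 - |χ|) / 2) :
    |a| ≤ (1 + |χ|) / 2 * M := by
  have h1 : |a / M| ≤ |χ| + (1 - |χ|) / 2 := by
    have := abs_sub_abs_le_abs_sub (a / M) χ
    linarith
  rw [abs_div, abs_of_pos hM, div_le_iff₀ hM] at h1
  linarith

/-- **Normal form of the crux.** `BulkKerrCaptureC2` (uniform `C²` capture on the compact spin sets
`|a| ≤ a₁ M`, `a₁ < 1`, at the leaf `r₀ = M`) is EQUIVALENT to locally-uniform pointwise `C²` capture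
at the unit normalised leaf: around every normalised sub-extremal centre `χ ∈ (−1, 1)` there are
`(s, δ)`, a spin radius `ς > 0` and, per `(M, η)`, one basin `ε > 0` with
`BulkKerrCaptureC2.Negative.CaptureC2At s δ M _ ε η a` for every sub-extremal spin `a` with
`|a/M − χ| < ς`. (`→`: threshold `a₁ := (1 + |χ|)/2`, radius `(1 − |χ|)/2`; `←`: the Lebesgue number,
`uniform_of_locallyUniform`, with `CaptureC2At.mono`.) The only content of the crux beyond the
pointwise `k = 2` theorem at each centre is this local uniformity of `(s, δ, ε)` in the spin — Hintz's
Remark 13.2. [folklore] -/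
theorem bulkKerrCaptureC2_iff_locallyUniform :
    BulkKerrCaptureC2 ↔
      ∀ [Kerr.Facts] [Kerr.SliceFacts], ∀ χ : ℝ, |χ| < 1 → ∃ (s : ℕ) (δ : ℝ), ∃ ς > (0 : ℝ),
        ∀ (M : ℝ) (hM : 0 < M), ∀ η > (0 : ℝ), ∃ ε > (0 : ℝ), ∀ a : ℝ, |a / M - χ| < ς →
          Kerr.IsSubextremal M a → Negative.CaptureC2At s δ M hM.le ε η a := by
  rw [Negative.bulkKerrCaptureC2_iff_captureC2At]
  constructor
  · intro h _ _ χ hχ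
    have ha₁ : (1 + |χ|) / 2 < 1 := by linarith
    obtain ⟨s, δ, H⟩ := h ((1 + |χ|) / 2) ha₁
    refine ⟨s, δ, (1 - |χ|) / 2, by linarith, fun M hM η hη ↦ ?_⟩
    obtain ⟨ε, hε, Hε⟩ := H M hM η hη
    exact ⟨ε, hε, fun a ha _ ↦ Hε a (spin_le_of_near_centre hM ha)⟩
  · intro h _ _
    refine uniform_of_locallyUniform (fun s δ M hM η ε a ↦ Negative.CaptureC2At s δ M hM.le ε η a)
      (fun hs hδ hε hg ↦ hg.mono hs hδ hε le_rfl) fun χ hχ ↦ ?_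
    obtain ⟨s, δ, ς, hς, H⟩ := h χ hχ
    -- shrink the spin radius so that every served spin is sub-extremal
    refine ⟨s, δ, min ς ((1 - |χ|) / 2), lt_min hς (by linarith), fun M hM η hη ↦ ?_⟩
    obtain ⟨ε, hε, Hε⟩ := H M hM η hη
    refine ⟨ε, hε, fun a ha ↦ Hε a (ha.trans_le (min_le_left _ _)) ?_⟩
    exact Negative.isSubextremal_of_spin_le (a₁ := (1 + |χ|) / 2) (by linarith) hM
      (spin_le_of_near_centre hM (ha.trans_le (min_le_right _ _)))

/-- **Registered stub `stub_bulkKerrCaptureC2_iff_unitLeafGermTwo` of line `SketchStandalone`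
(skeleton v3) — the crux is the order-two unit-leaf germ of the claim, literally.** `BulkKerrCaptureC2` ↔
the statement of `Literature.Geometry.Lorentzian.hintz_kerr_stability_subextremal_cauchy_allOrders.atUnitLeaf`
with the all-orders conclusion `∀ k, ConvergesToKerr 𝒟oc M' a' k` replaced by its `k = 2` instance:
around every normalised sub-extremal centre `χ₀`, exponents `(s, δ)`, a spin radius `ς > 0` and per
`(M, η)` one basin `ε > 0` such that for every sub-extremal spin with `|a/M − χ₀| < ς`, every
b-conormal `ε`-close vacuum datum on `Kerr.slice a M` has all its maximal vacuum Cauchy developments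
with sub-extremal final parameters within `η`, sojourn-complete far `𝓘⁺`
(`HasCompleteFutureNullInfinityFar`) and a region converging to `g_{M',a'}` in `C²`. This pins the
item's debt: nothing short of this instance of Hintz's Thm. 13.1 + Rem. 13.2 closes the crux, and
that instance does (`→`/`←` of `bulkKerrCaptureC2_iff_locallyUniform`, conclusion reordered).
[folklore] -/
theorem stub_bulkKerrCaptureC2_iff_unitLeafGermTwo :
    BulkKerrCaptureC2 ↔
      ∀ [Kerr.Facts] [Kerr.SliceFacts], ∀ χ₀ : ℝ, |χ₀| < 1 →
        ∃ (s : ℕ) (δ : ℝ), ∃ ς > (0 : ℝ), ∀ (M : ℝ) (hM : 0 < M), ∀ η > (0 : ℝ), ∃ ε > (0 : ℝ),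
          ∀ a : ℝ, |a / M - χ₀| < ς → Kerr.IsSubextremal M a →
            ∀ (D : InitialDataSet 𝓘(ℝ, E3) (Kerr.slice a M)) [D.metric.HasLeviCivita],
              D.IsVacuumConstraintSolution →
              (∀ s' : ℕ,
                InitialDataSet.dataWeightedSobolevEDist s' δ D (Kerr.data M a M hM.le) < ⊤) →
              InitialDataSet.dataWeightedSobolevEDist s δ D (Kerr.data M a M hM.le) <
                ENNReal.ofReal ε →
              ∀ 𝒟 : VacuumCauchyDevelopment D, 𝒟.IsMaximal →
                ∃ (M' a' : ℝ) (𝒟oc : Set 𝒟.carrier), Kerr.IsSubextremal M' a' ∧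
                  |M' - M| + |a' - a| ≤ η ∧
                  𝒟.HasCompleteFutureNullInfinityFar ∧
                  𝒟.toSpacetime.ConvergesToKerr 𝒟oc M' a' 2 := by
  rw [bulkKerrCaptureC2_iff_locallyUniform]
  constructor
  · intro h _ _ χ₀ hχ₀
    obtain ⟨s, δ, ς, hς, H⟩ := h χ₀ hχ₀
    refine ⟨s, δ, ς, hς, fun M hM η hη ↦ ?_⟩
    obtain ⟨ε, hε, Hε⟩ := H M hM η hη
    refine ⟨ε, hε, fun a ha hsub D _ hvac hcon hdist 𝒟 hmax ↦ ?_⟩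
    obtain ⟨M', a', 𝒟oc, hsub', hfar, hconv, hpar⟩ := Hε a ha hsub D hvac hcon hdist 𝒟 hmax
    exact ⟨M', a', 𝒟oc, hsub', hpar, hfar, hconv⟩
  · intro h _ _ χ₀ hχ₀
    obtain ⟨s, δ, ς, hς, H⟩ := h χ₀ hχ₀
    refine ⟨s, δ, ς, hς, fun M hM η hη ↦ ?_⟩
    obtain ⟨ε, hε, Hε⟩ := H M hM η hη
    refine ⟨ε, hε, fun a ha hsub D _ hvac hcon hdist 𝒟 hmax ↦ ?_⟩
    obtain ⟨M', a', 𝒟oc, hsub', hpar, hfar, hconv⟩ := Hε a ha hsub D hvac hcon hdist 𝒟 hmax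
    exact ⟨M', a', 𝒟oc, hsub', hfar, hconv, hpar⟩

/-- **Registered stub `stub_unitLeafGermTwo_of_allOrdersClaim` of line `SketchStandalone` (skeleton
v3) — the order-two unit-leaf germ from the named claim** (`….atUnitLeaf`, p97189, at `k := 2`): the
right-hand side of `stub_bulkKerrCaptureC2_iff_unitLeafGermTwo` follows from
`hintz_kerr_stability_subextremal_cauchy_allOrders` (at all instances of the two `Prop`-classes).
CONDITIONAL on that unrefereed claim, like `Theorems.bulkKerrCaptureC2_of_allOrdersClaim'` (p99464),
which it re-derives as `stub_bulkKerrCaptureC2_iff_unitLeafGermTwo.2 ∘ stub_unitLeafGermTwo_of_allOrdersClaim`.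
[cite: Hintz2026, Thm. 13.1 (pp. 318–319) and Remark 13.2 (p. 319)] -/
theorem stub_unitLeafGermTwo_of_allOrdersClaim :
    (∀ [Kerr.Facts] [Kerr.SliceFacts], hintz_kerr_stability_subextremal_cauchy_allOrders) →
    ∀ [Kerr.Facts] [Kerr.SliceFacts], ∀ χ₀ : ℝ, |χ₀| < 1 →
      ∃ (s : ℕ) (δ : ℝ), ∃ ς > (0 : ℝ), ∀ (M : ℝ) (hM : 0 < M), ∀ η > (0 : ℝ), ∃ ε > (0 : ℝ),
        ∀ a : ℝ, |a / M - χ₀| < ς → Kerr.IsSubextremal M a →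
          ∀ (D : InitialDataSet 𝓘(ℝ, E3) (Kerr.slice a M)) [D.metric.HasLeviCivita],
            D.IsVacuumConstraintSolution →
            (∀ s' : ℕ,
              InitialDataSet.dataWeightedSobolevEDist s' δ D (Kerr.data M a M hM.le) < ⊤) →
            InitialDataSet.dataWeightedSobolevEDist s δ D (Kerr.data M a M hM.le) <
              ENNReal.ofReal ε →
            ∀ 𝒟 : VacuumCauchyDevelopment D, 𝒟.IsMaximal →
              ∃ (M' a' : ℝ) (𝒟oc : Set 𝒟.carrier), Kerr.IsSubextremal M' a' ∧
                |M' - M| + |a' - a| ≤ η ∧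
                𝒟.HasCompleteFutureNullInfinityFar ∧
                𝒟.toSpacetime.ConvergesToKerr 𝒟oc M' a' 2 := by
  intro hclaim _ _ χ₀ hχ₀
  obtain ⟨s, δ, ς, hς, H⟩ := hclaim.atUnitLeaf χ₀ hχ₀
  refine ⟨s, δ, ς, hς, fun M hM η hη ↦ ?_⟩
  obtain ⟨ε, hε, Hε⟩ := H M hM η hη
  refine ⟨ε, hε, fun a ha hsub D _ hvac hcon hdist 𝒟 hmax ↦ ?_⟩
  obtain ⟨M', a', 𝒟oc, hsub', hpar, hfar, hconv⟩ := Hε a ha hsub D hvac hcon hdist 𝒟 hmax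
  exact ⟨M', a', 𝒟oc, hsub', hpar, hfar, hconv 2⟩

end Summit.FinalStateConjecture.FinalStateConjecture.Theorems.BulkKerrCaptureC2.NormalForm

end
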